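import Mathlib
import Literature.Analysis.FluidPDE.GaussianVortexPlanar
import HarnessLib
import Summits.AnomalousDissipation.AnomalousDissipation.Theorems.MarginalStabilityChainStretchedVortexRowsStubCellSolvabilityRadialWeights

/-!
# `cellStream_sqrtPotential` — registered helper stub toward `stub_cellStreamSolvability`
(crux stmt-AnomalousDissipation-3009 `MarginalStabilityChain.StretchedVortexRows`, line `braid-closed-large-circulation-gluing`)

The calculus of `q := √V`, where `V(ξ) = 4πG(ξ)/φ(|ξ|²/4)` is the potential of the cell stream
equation `ΔΨ + VΨ = F` (`G = gaussVortexProfile = (4π)⁻¹e^{−|ξ|²/4}`, `φ = burgersPhi`,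
`φ(t) = (1 − e^{−t})/t`). With `s = |ξ|²/4` one has `4πG = e^{−s}`, so `V = e^{−s}/φ(s) > 0`.
We prove: `q` is smooth (`V > 0` is smooth, `Real.sqrt` is smooth off `0`), `q > 0`, `q² = V`,
`e^{−|ξ|²/8} ≤ q` (from `φ ≤ 1` on `[0,∞)`), `q ≤ (1+|ξ|)e^{−|ξ|²/8}` (from `1/φ(s) ≤ 1 + s ≤ (1+|ξ|)²`),
`‖Dq‖ ≤ 2(1+|ξ|)³e^{−|ξ|²/8}` (from `Dq = DV/(2q)`, `‖DV‖ ≤ 8π(1+|ξ|)³G = 2(1+|ξ|)³e^{−|ξ|²/4}`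
— the landed `cellPotential_bound` — and `q ≥ e^{−|ξ|²/8}`), and radiality.
-/

set_option linter.dupNamespace false

noncomputable section

open scoped BigOperators Topology RealInnerProductSpace ContDiff Laplacian
open Filter Set Function MeasureTheory WithLp

namespace Summit.AnomalousDissipation.AnomalousDissipation.Theorems.MarginalStabilityChainStretchedVortexRows

open Literature.Analysis.FluidPDE

/-- `4π G(ξ) = e^{−|ξ|²/4}`. [folklore] -/
private theorem sqrtPot_four_pi_mul_gauss (ξ : EuclideanSpace ℝ (Fin 2)) :
    4 * Real.pi * gaussVortexProfile ξ = Real.exp (-(‖ξ‖ ^ 2 / 4)) := by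
  rw [gaussVortexProfile, ← mul_assoc, mul_inv_cancel₀ (by positivity), one_mul]

/-- `e^{−|ξ|²/8}² = e^{−|ξ|²/4}`. [folklore] -/
private theorem sqrtPot_exp_eighth_sq (ξ : EuclideanSpace ℝ (Fin 2)) :
    Real.exp (-(1 / 8) * ‖ξ‖ ^ 2) ^ 2 = Real.exp (-(‖ξ‖ ^ 2 / 4)) := by
  rw [sq, ← Real.exp_add]
  congr 1
  ring

/-- `V > 0`. [folklore] -/
private theorem sqrtPot_pos (ξ : EuclideanSpace ℝ (Fin 2)) :
    0 < 4 * Real.pi * gaussVortexProfile ξ / burgersPhi (‖ξ‖ ^ 2 / 4) :=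
  div_pos (mul_pos (by positivity) (gaussVortexProfile_pos ξ)) (burgersPhi_pos _)

/-- `e^{−|ξ|²/4} ≤ V` (since `φ ≤ 1` on `[0, ∞)`). [folklore] -/
private theorem sqrtPot_exp_le (ξ : EuclideanSpace ℝ (Fin 2)) :
    Real.exp (-(‖ξ‖ ^ 2 / 4)) ≤ 4 * Real.pi * gaussVortexProfile ξ / burgersPhi (‖ξ‖ ^ 2 / 4) := by
  rw [sqrtPot_four_pi_mul_gauss, le_div_iff₀ (burgersPhi_pos _)]
  exact mul_le_of_le_one_right (Real.exp_pos _).le (burgersPhi_le_one (by positivity))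

/-- `V ≤ (1+|ξ|)² e^{−|ξ|²/4}` (since `1/φ(s) ≤ 1 + s ≤ (1+|ξ|)²`, `s = |ξ|²/4`). [folklore] -/
private theorem sqrtPot_le_sq_mul_exp (ξ : EuclideanSpace ℝ (Fin 2)) :
    4 * Real.pi * gaussVortexProfile ξ / burgersPhi (‖ξ‖ ^ 2 / 4) ≤
      (1 + ‖ξ‖) ^ 2 * Real.exp (-(‖ξ‖ ^ 2 / 4)) := by
  rw [sqrtPot_four_pi_mul_gauss, div_eq_mul_inv, mul_comm ((1 + ‖ξ‖) ^ 2)]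
  refine mul_le_mul_of_nonneg_left ?_ (Real.exp_pos _).le
  calc (burgersPhi (‖ξ‖ ^ 2 / 4))⁻¹ ≤ 1 + ‖ξ‖ ^ 2 / 4 := inv_burgersPhi_le (by positivity)
    _ ≤ (1 + ‖ξ‖) ^ 2 := by nlinarith [norm_nonneg ξ]

/-- `e^{−|ξ|²/8} ≤ √V`. [folklore] -/
private theorem sqrtPot_exp_le_sqrt (ξ : EuclideanSpace ℝ (Fin 2)) :
    Real.exp (-(1 / 8) * ‖ξ‖ ^ 2) ≤
      Real.sqrt (4 * Real.pi * gaussVortexProfile ξ / burgersPhi (‖ξ‖ ^ 2 / 4)) := by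
  rw [Real.le_sqrt' (Real.exp_pos _), sqrtPot_exp_eighth_sq]
  exact sqrtPot_exp_le ξ

/-- `√V ≤ (1+|ξ|) e^{−|ξ|²/8}`. [folklore] -/
private theorem sqrtPot_sqrt_le (ξ : EuclideanSpace ℝ (Fin 2)) :
    Real.sqrt (4 * Real.pi * gaussVortexProfile ξ / burgersPhi (‖ξ‖ ^ 2 / 4)) ≤
      (1 + ‖ξ‖) * Real.exp (-(1 / 8) * ‖ξ‖ ^ 2) := by
  rw [Real.sqrt_le_left (by positivity), mul_pow, sqrtPot_exp_eighth_sq]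
  exact sqrtPot_le_sq_mul_exp ξ

/-- `‖D√V‖ ≤ 2(1+|ξ|)³ e^{−|ξ|²/8}` (`D√V = DV/(2√V)`, `‖DV‖ ≤ 2(1+|ξ|)³e^{−|ξ|²/4}`,
`√V ≥ e^{−|ξ|²/8}`). [folklore] -/
private theorem sqrtPot_norm_fderiv_le (ξ : EuclideanSpace ℝ (Fin 2)) :
    ‖fderiv ℝ (fun ξ : EuclideanSpace ℝ (Fin 2) =>
        Real.sqrt (4 * Real.pi * gaussVortexProfile ξ / burgersPhi (‖ξ‖ ^ 2 / 4))) ξ‖ ≤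
      2 * (1 + ‖ξ‖) ^ 3 * Real.exp (-(1 / 8) * ‖ξ‖ ^ 2) := by
  have hd : DifferentiableAt ℝ (fun ξ : EuclideanSpace ℝ (Fin 2) =>
      4 * Real.pi * gaussVortexProfile ξ / burgersPhi (‖ξ‖ ^ 2 / 4)) ξ :=
    (contDiff_cellPotential (n := 1)).differentiable (by simp) ξ
  rw [fderiv_sqrt hd (sqrtPot_pos ξ).ne', norm_smul, ← norm_gradient_eq_norm_fderiv_fin_two,
    Real.norm_eq_abs, abs_of_pos (by have := Real.sqrt_pos.2 (sqrtPot_pos ξ); positivity)]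
  set a : ℝ := Real.sqrt (4 * Real.pi * gaussVortexProfile ξ / burgersPhi (‖ξ‖ ^ 2 / 4)) with ha
  set E : ℝ := Real.exp (-(1 / 8) * ‖ξ‖ ^ 2) with hE
  have hEpos : 0 < E := Real.exp_pos _
  have hEa : E ≤ a := sqrtPot_exp_le_sqrt ξ
  have hapos : 0 < a := hEpos.trans_le hEa
  have hgrad : ‖gradient (fun ξ : EuclideanSpace ℝ (Fin 2) =>
      4 * Real.pi * gaussVortexProfile ξ / burgersPhi (‖ξ‖ ^ 2 / 4)) ξ‖ ≤
      2 * (1 + ‖ξ‖) ^ 3 * E ^ 2 := by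
    have h := cellPotential_bound ξ
    have habs := abs_nonneg (4 * Real.pi * gaussVortexProfile ξ / burgersPhi (‖ξ‖ ^ 2 / 4))
    have hG : 8 * Real.pi * (1 + ‖ξ‖) ^ 3 * gaussVortexProfile ξ = 2 * (1 + ‖ξ‖) ^ 3 * E ^ 2 := by
      rw [hE, sqrtPot_exp_eighth_sq, ← sqrtPot_four_pi_mul_gauss]; ring
    linarith
  have hc : 0 ≤ (1 + ‖ξ‖) ^ 3 := by positivity
  rw [div_mul_eq_mul_div, one_mul, div_le_iff₀ (by positivity)]
  calc ‖gradient (fun ξ : EuclideanSpace ℝ (Fin 2) =>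
        4 * Real.pi * gaussVortexProfile ξ / burgersPhi (‖ξ‖ ^ 2 / 4)) ξ‖
      ≤ 2 * (1 + ‖ξ‖) ^ 3 * E ^ 2 := hgrad
    _ = 2 * (1 + ‖ξ‖) ^ 3 * E * E := by ring
    _ ≤ 2 * (1 + ‖ξ‖) ^ 3 * E * (2 * a) := by
        refine mul_le_mul_of_nonneg_left ?_ (by positivity)
        linarith

/-- **The square root of the cell potential** (registered on stmt-AnomalousDissipation-3009 as the
sub-goal `cellStream_sqrtPotential` toward `stub_cellStreamSolvability`). For
`V(ξ) = 4πG(ξ)/φ(|ξ|²/4) = (|ξ|²/4)/(e^{|ξ|²/4} − 1)` and `q := √V`: `q` is smooth, `q > 0`,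
`q² = V`, `e^{−|ξ|²/8} ≤ q ≤ (1+|ξ|)e^{−|ξ|²/8}`, `‖Dq‖ ≤ 2(1+|ξ|)³e^{−|ξ|²/8}`, and `q` is radial.
[folklore] -/
theorem cellStream_sqrtPotential :
    ContDiff ℝ ∞ (fun ξ : EuclideanSpace ℝ (Fin 2) =>
      Real.sqrt (4 * Real.pi * gaussVortexProfile ξ / burgersPhi (‖ξ‖ ^ 2 / 4))) ∧
    (∀ ξ : EuclideanSpace ℝ (Fin 2),
      0 < Real.sqrt (4 * Real.pi * gaussVortexProfile ξ / burgersPhi (‖ξ‖ ^ 2 / 4))) ∧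
    (∀ ξ : EuclideanSpace ℝ (Fin 2),
      Real.sqrt (4 * Real.pi * gaussVortexProfile ξ / burgersPhi (‖ξ‖ ^ 2 / 4)) ^ 2 =
        4 * Real.pi * gaussVortexProfile ξ / burgersPhi (‖ξ‖ ^ 2 / 4)) ∧
    (∀ ξ : EuclideanSpace ℝ (Fin 2),
      Real.exp (-(1 / 8) * ‖ξ‖ ^ 2) ≤
        Real.sqrt (4 * Real.pi * gaussVortexProfile ξ / burgersPhi (‖ξ‖ ^ 2 / 4))) ∧
    (∀ ξ : EuclideanSpace ℝ (Fin 2),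
      Real.sqrt (4 * Real.pi * gaussVortexProfile ξ / burgersPhi (‖ξ‖ ^ 2 / 4)) ≤
        (1 + ‖ξ‖) * Real.exp (-(1 / 8) * ‖ξ‖ ^ 2)) ∧
    (∀ ξ : EuclideanSpace ℝ (Fin 2),
      ‖fderiv ℝ (fun ξ : EuclideanSpace ℝ (Fin 2) =>
          Real.sqrt (4 * Real.pi * gaussVortexProfile ξ / burgersPhi (‖ξ‖ ^ 2 / 4))) ξ‖ ≤
        2 * (1 + ‖ξ‖) ^ 3 * Real.exp (-(1 / 8) * ‖ξ‖ ^ 2)) ∧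
    (∀ ξ η : EuclideanSpace ℝ (Fin 2), ‖ξ‖ = ‖η‖ →
      Real.sqrt (4 * Real.pi * gaussVortexProfile ξ / burgersPhi (‖ξ‖ ^ 2 / 4)) =
        Real.sqrt (4 * Real.pi * gaussVortexProfile η / burgersPhi (‖η‖ ^ 2 / 4))) := by
  refine ⟨contDiff_cellPotential.sqrt fun ξ => (sqrtPot_pos ξ).ne',
    fun ξ => Real.sqrt_pos.2 (sqrtPot_pos ξ), fun ξ => Real.sq_sqrt (sqrtPot_pos ξ).le,
    sqrtPot_exp_le_sqrt, sqrtPot_sqrt_le, sqrtPot_norm_fderiv_le, fun ξ η h => ?_⟩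
  simp only [gaussVortexProfile, h]

end Summit.AnomalousDissipation.AnomalousDissipation.Theorems.MarginalStabilityChainStretchedVortexRows

end
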